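import Summits.QuantumFields.YangMills.Theorems.TubeZeroFreeChannel.Negative.ZeroFreeAnalytic
import Literature.MathematicalPhysics.QuantumFieldTheory.PeriodicBoxPartitionFunction
import Summits.QuantumFields.YangMills.Theses.ComplexCouplingChannel

/-!
# `TubeZeroFreeChannel` — negative-side support II: a real wall of the bulk free energy blocks the axis

Support file for the crux `stmt-QuantumFields-18841` (`ComplexCouplingChannel.TubeZeroFreeChannel`),
extracted from the disprover's work file `Cruxes/TubeZeroFreeChannel/Disproof.lean`. Everything is
proved; the only definition is `boxZ`, the VERBATIM copy of the crux's inline `let Zc` (complex-coupling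
Wilson partition function of the periodic box `a³ × t`), equal to the Literature box partition function
`(boxSystem r.ρ ![a,a,a,t]).partZ univ` (`boxZ_eq_partZ`), so that `tubeZeroFreeChannel_iff_boxZ` is
`Iff.rfl`. The crux lets its zero-free set `D` be merely open and connected (x5's corridor and the card
`zero-free-wilson-partition-function-gap` picture an axis-hugging strip); the freedom to DETOUR is
load-bearing:
* `norm_partZ_le`, `partZ_ofReal`, `norm_boxZ_le`, `boxZ_ofReal`, `differentiable_boxZ`: the volume
  bounds `e^{-6M|x|a³t} ≤ Z(x; a, t)` (real), `|Z(z; a, t)| ≤ e^{6M|z|a³t}` (`M = costBound r.ρ`), entirety.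
* `analyticAt_of_boxZ_zeroFree`: for EVERY compact `G` and continuous unitary `r` (simplicity unused),
  uniform tube zero-freeness on a disc about a real coupling `c` (`∃ L₀ ∀ L ≥ L₀ ∃ t₀ ∀ t ≥ t₀`) plus
  existence near `c` of the tube rates `e L x = lim_t (L³t)⁻¹ log Z(x; L, t)` and of the bulk free
  energy `f = lim_L e L` force `f` to be real analytic at `c` (`ZeroFreeAnalytic.lean`).
* `not_zeroFree_ball_of_not_analyticAt`, `not_zeroFree_of_mem` (**AxisBlocked**): a WALL — a real `c`
  near which those limits exist and `f` is NOT analytic — lies in no uniformly zero-free open set;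
  `exists_nonreal_mem_of_zeroFree_connected`: an open connected uniformly zero-free `D` with real points
  on both sides of a wall misses `c` and meets `Re z = c` at a NON-REAL point; `channel_detours_of_wall`:
  every channel the crux provides for `β > c` detours through `ℂ ∖ ℝ`; `not_stripChannel_of_wall`: the
  strip form of the crux (a `δ`-box about `[0, β]` uniformly zero-free; it implies the crux) is FALSE
  once ONE admissible `(G, r)` has a wall.
Walls in print: for `G = SU(N)` and the faithful unitary `r_p = (2N·𝟙 ⊕ V ⊕ V̄)^{⊗p}` the Wilson
action is `(4N)^p Σ_P [1 − ((1 + Re tr U_P/N)/2)^p]`, the van Enter–Shlosman nonlinear gauge action;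
their Thm. 2 (Commun. Math. Phys. 255 (2005) 21–32, doi:10.1007/s00220-004-1286-1 = arXiv:cond-mat/0306362,
p. 3: "in dimension 3 and more and p high enough, there is a first order transition, that is there
exists a temperature at which the free energy is not differentiable") gives a wall `c = z_t(p) > 0`
(granted the standard van Hove existence of the limits; neither is formalised here). Numerically the
Wilson axes of `SO(3)`, `SU(N ≥ 4)` fundamental and `G₂` carry first-order bulk transitions too; there
any proof of the crux must build complex detours, whose existence is not known.
-/

noncomputable section

open Filter Set Metric Topology MeasureTheory
open Literature.MathematicalPhysics.QuantumFieldTheory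

namespace Summit.QuantumFields.YangMills.Theorems.TubeZeroFreeChannel.Negative

/-! ### II. Volume bounds for the box partition functions of the tree -/

section PartZ

variable {d : ℕ} {G : Type*} {ι : Type*} [Group G] [TopologicalSpace G] [IsTopologicalGroup G]
  [CompactSpace G] [MeasurableSpace G] [BorelSpace G] {S : PlaqSystem d G ι} {M : ℝ} {D : ℕ}

/-- **Volume bound at complex coupling**: `|Z_W(β)| ≤ exp(|β| · |W| · M)` for a regular plaquette
system with `|s_p| ≤ M` (triangle inequality under the Haar integral). [folklore] -/
theorem norm_partZ_le (hR : S.Regular M D) (W : Finset ι) (β : ℂ) :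
    ‖S.partZ W β‖ ≤ Real.exp (‖β‖ * (W.card * M)) := by
  classical
  have hpart : S.partZ W β = ∫ U, (1 : ℂ) * Complex.exp (-(β * ∑ p ∈ W, (S.cost p U : ℂ))) ∂(zdHaar d G) :=
    S.numZ_eq_integral_exp (fun _ => 1) W β
  have hTb : ∀ U, ‖∑ p ∈ W, (S.cost p U : ℂ)‖ ≤ W.card * M := by
    intro U
    refine (norm_sum_le _ _).trans ?_
    calc ∑ p ∈ W, ‖(S.cost p U : ℂ)‖ ≤ ∑ p ∈ W, M :=
          Finset.sum_le_sum fun p _ => by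
            rw [Complex.norm_real, Real.norm_eq_abs]; exact hR.abs_cost_le p U
      _ = W.card * M := by simp
  have hexp : ∀ U, ‖(1 : ℂ) * Complex.exp (-(β * ∑ p ∈ W, (S.cost p U : ℂ)))‖ ≤
      Real.exp (‖β‖ * (W.card * M)) := by
    intro U
    rw [one_mul, Complex.norm_exp]
    refine Real.exp_le_exp.2 ((Complex.re_le_norm _).trans ?_)
    rw [norm_neg, norm_mul]
    gcongr
    exact hTb U
  rw [hpart]
  calc ‖∫ U, (1 : ℂ) * Complex.exp (-(β * ∑ p ∈ W, (S.cost p U : ℂ))) ∂(zdHaar d G)‖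
      ≤ ∫ U, ‖(1 : ℂ) * Complex.exp (-(β * ∑ p ∈ W, (S.cost p U : ℂ)))‖ ∂(zdHaar d G) :=
        norm_integral_le_integral_norm _
    _ ≤ ∫ _U, Real.exp (‖β‖ * (W.card * M)) ∂(zdHaar d G) :=
        integral_mono_of_nonneg (Eventually.of_forall fun U => norm_nonneg _) (integrable_const _)
          (Eventually.of_forall hexp)
    _ = Real.exp (‖β‖ * (W.card * M)) := by simp

/-- **Reality and the lower volume bound at real coupling**: for real `x`, `Z_W(x)` is a real
number `≥ exp(-|x| · |W| · M) > 0` (the integrand is real and pointwise at least that large,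
the Haar product is a probability measure). [folklore] -/
theorem partZ_ofReal (hR : S.Regular M D) (W : Finset ι) (x : ℝ) :
    ∃ y : ℝ, Real.exp (-(|x| * (W.card * M))) ≤ y ∧ S.partZ W x = y := by
  classical
  have hpart : S.partZ W x = ∫ U, (1 : ℂ) * Complex.exp (-((x : ℂ) * ∑ p ∈ W, (S.cost p U : ℂ))) ∂(zdHaar d G) :=
    S.numZ_eq_integral_exp (fun _ => 1) W x
  set g : ZdGaugeConfig d G → ℝ := fun U => Real.exp (-(x * ∑ p ∈ W, S.cost p U)) with hg
  have hgm : Measurable g :=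
    Real.measurable_exp.comp ((Finset.measurable_sum _ fun p _ => hR.measurable_cost p).const_mul x).neg
  have hTb : ∀ U, |∑ p ∈ W, S.cost p U| ≤ W.card * M := by
    intro U
    refine (Finset.abs_sum_le_sum_abs _ _).trans ?_
    calc ∑ p ∈ W, |S.cost p U| ≤ ∑ p ∈ W, M := Finset.sum_le_sum fun p _ => hR.abs_cost_le p U
      _ = W.card * M := by simp
  have hglb : ∀ U, Real.exp (-(|x| * (W.card * M))) ≤ g U := by
    intro U
    refine Real.exp_le_exp.2 ?_
    have h1 : x * ∑ p ∈ W, S.cost p U ≤ |x| * (W.card * M) := by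
      calc x * ∑ p ∈ W, S.cost p U ≤ |x * ∑ p ∈ W, S.cost p U| := le_abs_self _
        _ = |x| * |∑ p ∈ W, S.cost p U| := abs_mul _ _
        _ ≤ |x| * (W.card * M) := mul_le_mul_of_nonneg_left (hTb U) (abs_nonneg _)
    linarith
  have hgub : ∀ U, g U ≤ Real.exp (|x| * (W.card * M)) := by
    intro U
    refine Real.exp_le_exp.2 ?_
    have h1 : -(x * ∑ p ∈ W, S.cost p U) ≤ |x| * (W.card * M) := by
      calc -(x * ∑ p ∈ W, S.cost p U) ≤ |x * ∑ p ∈ W, S.cost p U| := neg_le_abs _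
        _ = |x| * |∑ p ∈ W, S.cost p U| := abs_mul _ _
        _ ≤ |x| * (W.card * M) := mul_le_mul_of_nonneg_left (hTb U) (abs_nonneg _)
    linarith
  have hgi : Integrable g (zdHaar d G) := by
    refine Integrable.mono' (integrable_const (Real.exp (|x| * (W.card * M)))) hgm.aestronglyMeasurable ?_
    exact Eventually.of_forall fun U => by
      rw [Real.norm_eq_abs, abs_of_pos (Real.exp_pos _)]; exact hgub U
  refine ⟨∫ U, g U ∂(zdHaar d G), ?_, ?_⟩
  · calc Real.exp (-(|x| * (W.card * M))) = ∫ _U, Real.exp (-(|x| * (W.card * M))) ∂(zdHaar d G) := by simp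
      _ ≤ ∫ U, g U ∂(zdHaar d G) := integral_mono (integrable_const _) hgi hglb
  · rw [hpart]
    have : ∀ U, (1 : ℂ) * Complex.exp (-((x : ℂ) * ∑ p ∈ W, (S.cost p U : ℂ))) = ((g U : ℝ) : ℂ) := by
      intro U
      simp only [hg, one_mul, Complex.ofReal_exp, Complex.ofReal_neg, Complex.ofReal_mul,
        Complex.ofReal_sum]
    simp_rw [this]
    exact integral_ofReal

end PartZ

/-! ### III. The crux's `Zc` and the wall theorems -/

section Crux

variable {G : Type} [Group G] [TopologicalSpace G] [IsTopologicalGroup G] [CompactSpace G]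
  [MeasurableSpace G] [BorelSpace G]

/-- The complex-coupling Wilson partition function of the periodic box `a³ × t` in the
representation `r` — VERBATIM the `let Zc` of the route decl `TubeZeroFreeChannel` (so that
`tubeZeroFreeChannel_iff_boxZ` below is `Iff.rfl`). [folklore] -/
def boxZ (r : LatticeRep G) (z : ℂ) (a t : ℕ) : ℂ :=
  let St := Fin a × Fin a × Fin a × Fin t
  let sh : St → Fin 4 → St := fun x μ => ![(finRotate a x.1, x.2.1, x.2.2.1, x.2.2.2),
    (x.1, finRotate a x.2.1, x.2.2.1, x.2.2.2), (x.1, x.2.1, finRotate a x.2.2.1, x.2.2.2),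
    (x.1, x.2.1, x.2.2.1, finRotate t x.2.2.2)] μ
  let pl : (St × Fin 4 → G) → St → Fin 4 → Fin 4 → G := fun U x μ ν =>
    U (x, μ) * U (sh x μ, ν) * (U (sh x ν, μ))⁻¹ * (U (x, ν))⁻¹
  ∫ U, Complex.exp (-(z * ((∑ x : St, ∑ q : {q : Fin 4 × Fin 4 // q.1 < q.2},
    ((r.N : ℝ) - (r.ρ (pl U x q.1.1 q.1.2)).trace.re) : ℝ) : ℂ)))
    ∂(Measure.pi fun _ : St × Fin 4 => haarProbability G)

/-- DICTIONARY: `boxZ` is the Literature box partition function `(boxSystem r.ρ ![a,a,a,t]).partZ univ`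
(`boxSystem_partZ_univ_eq_finTorus`). [folklore] -/
theorem boxZ_eq_partZ (r : LatticeRep G) (z : ℂ) (a t : ℕ) :
    boxZ r z a t = (boxSystem r.ρ (![a, a, a, t] : Fin 4 → ℕ)).partZ Finset.univ z :=
  (boxSystem_partZ_univ_eq_finTorus r.ρ r.continuous a a a t z).symm

/-- The box `a³ × t` has `6 a³ t` plaquettes. [folklore] -/
theorem card_boxLabel (a t : ℕ) :
    (Finset.univ : Finset (BoxLabel (![a, a, a, t] : Fin 4 → ℕ))).card = 6 * (a ^ 3 * t) := by
  rw [Finset.card_univ]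
  simp only [BoxLabel, BoxSite, BoxPair, Fintype.card_prod, Fintype.card_pi, Fintype.card_fin,
    Fin.prod_univ_four, Matrix.cons_val_zero, Matrix.cons_val_one, Matrix.cons_val]
  have : Fintype.card {q : Fin 4 × Fin 4 // q.1 < q.2} = 6 := by decide
  rw [this]; ring

/-- The crux's `Zc` is entire in the coupling (`PlaqSystem.differentiable_partZ`). [folklore] -/
theorem differentiable_boxZ (r : LatticeRep G) (a t : ℕ) : Differentiable ℂ (fun z => boxZ r z a t) := by
  have h := PlaqSystem.differentiable_partZ (boxSystem_regular (d := 4) (G := G) r.ρ r.continuous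
    (![a, a, a, t] : Fin 4 → ℕ)) Finset.univ
  have hfun : (fun z => boxZ r z a t) = (boxSystem r.ρ (![a, a, a, t] : Fin 4 → ℕ)).partZ Finset.univ :=
    funext fun z => boxZ_eq_partZ r z a t
  rw [hfun]; exact h

/-- **Volume bounds for the box partition function**: `|Z(z; a, t)| ≤ exp(6 M |z| a³ t)` with
`M = costBound r.ρ`. [folklore] -/
theorem norm_boxZ_le (r : LatticeRep G) (z : ℂ) (a t : ℕ) :
    ‖boxZ r z a t‖ ≤ Real.exp (‖z‖ * (6 * ((a : ℝ) ^ 3 * t) * costBound r.ρ)) := by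
  have h := norm_partZ_le (boxSystem_regular (d := 4) (G := G) r.ρ r.continuous
    (![a, a, a, t] : Fin 4 → ℕ)) Finset.univ z
  rw [card_boxLabel] at h
  rw [boxZ_eq_partZ]
  convert h using 2
  push_cast; ring

/-- **Reality and lower volume bound at real coupling**: `Z(x; a, t)` is real and
`≥ exp(-6 M |x| a³ t)`. [folklore] -/
theorem boxZ_ofReal (r : LatticeRep G) (x : ℝ) (a t : ℕ) :
    ∃ y : ℝ, Real.exp (-(|x| * (6 * ((a : ℝ) ^ 3 * t) * costBound r.ρ))) ≤ y ∧ boxZ r x a t = y := by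
  obtain ⟨y, hy, hZ⟩ := partZ_ofReal (boxSystem_regular (d := 4) (G := G) r.ρ r.continuous
    (![a, a, a, t] : Fin 4 → ℕ)) Finset.univ x
  rw [card_boxLabel] at hy
  refine ⟨y, ?_, by rw [boxZ_eq_partZ, hZ]⟩
  convert hy using 2
  push_cast; ring

/-- **Uniform tube zero-freeness about a real coupling `c` forces the bulk free energy to be
analytic at `c`.** For every compact gauge group `G` and continuous unitary `r` (simplicity is
not used): if the tube partition functions `Z(·; L, t)` of the crux have no zero in the disc
`B(c, R)` for `L ≥ L₀`, `t ≥ t₀(L)` (the crux's `UniformZeroFreeOn` at the set `B(c, R)`), and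
the tube rates `e L x = lim_t (L³t)⁻¹ log Z(x; L, t)` and the bulk free energy
`f x = lim_L e L x` exist for real `|x - c| < R`, then `f` is real analytic at `c`. [folklore] -/
theorem analyticAt_of_boxZ_zeroFree (r : LatticeRep G) {c R : ℝ} (hR : 0 < R)
    (hzf : ∃ L₀ : ℕ, ∀ L, L₀ ≤ L → ∃ t₀ : ℕ, ∀ t, t₀ ≤ t → ∀ z ∈ ball (c : ℂ) R, boxZ r z L t ≠ 0)
    {e : ℕ → ℝ → ℝ} {f : ℝ → ℝ}
    (he : ∃ L₁ : ℕ, ∀ L, L₁ ≤ L → ∀ x : ℝ, |x - c| < R →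
      Tendsto (fun t : ℕ => Real.log ‖boxZ r x L t‖ / ((L : ℝ) ^ 3 * t)) atTop (𝓝 (e L x)))
    (hf : ∀ x : ℝ, |x - c| < R → Tendsto (fun L => e L x) atTop (𝓝 (f x))) :
    AnalyticAt ℝ f c := by
  set M : ℝ := costBound r.ρ with hM
  have hM0 : 0 < M := costBound_pos r.ρ
  set K : ℝ := 6 * M * (|c| + R) with hK
  have hK0 : 0 ≤ K := by positivity
  have hnorm : ∀ z ∈ ball (c : ℂ) R, ‖z‖ ≤ |c| + R := by
    intro z hz
    have h1 : ‖z - (c : ℂ)‖ < R := by simpa [mem_ball, dist_eq_norm] using hz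
    calc ‖z‖ = ‖(c : ℂ) + (z - c)‖ := by ring_nf
      _ ≤ ‖(c : ℂ)‖ + ‖z - (c : ℂ)‖ := norm_add_le _ _
      _ ≤ |c| + R := by rw [Complex.norm_real, Real.norm_eq_abs]; linarith
  refine analyticAt_of_uniformly_zeroFree (Z := fun L t z => boxZ r z L t)
    (V := fun L t => (L : ℝ) ^ 3 * t) (K := K) hR hK0 ?_ ?_ ?_ ?_ ?_ hzf (e := e) (f := f) ?_ ?_
  · intro L t hL ht
    have h1 : (1 : ℝ) ≤ L := by exact_mod_cast hL
    have h2 : (1 : ℝ) ≤ t := by exact_mod_cast ht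
    nlinarith [one_le_pow₀ (n := 3) h1]
  · intro L t _ _
    exact (differentiable_boxZ r L t).differentiableOn
  · intro L t _ _ z hz
    refine (norm_boxZ_le r z L t).trans (Real.exp_le_exp.2 ?_)
    have hV0 : (0 : ℝ) ≤ (L : ℝ) ^ 3 * t := by positivity
    calc ‖z‖ * (6 * ((L : ℝ) ^ 3 * t) * M) ≤ (|c| + R) * (6 * ((L : ℝ) ^ 3 * t) * M) :=
          mul_le_mul_of_nonneg_right (hnorm z hz) (by positivity)
      _ = K * ((L : ℝ) ^ 3 * t) := by rw [hK]; ring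
  · intro L t _ _
    obtain ⟨y, hy, hZ⟩ := boxZ_ofReal r c L t
    have hy0 : 0 < y := lt_of_lt_of_le (Real.exp_pos _) hy
    rw [hZ, Complex.norm_real, Real.norm_eq_abs, abs_of_pos hy0]
    refine le_trans (Real.exp_le_exp.2 ?_) hy
    have hV0 : (0 : ℝ) ≤ (L : ℝ) ^ 3 * t := by positivity
    have : |c| * (6 * ((L : ℝ) ^ 3 * t) * M) ≤ K * ((L : ℝ) ^ 3 * t) := by
      rw [hK]
      have hR0 : 0 ≤ R := hR.le
      nlinarith [abs_nonneg c, mul_nonneg hV0 hM0.le]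
    linarith
  · intro L t _ _ x _
    obtain ⟨y, hy, hZ⟩ := boxZ_ofReal r x L t
    exact ⟨y, lt_of_lt_of_le (Real.exp_pos _) hy, hZ⟩
  · obtain ⟨L₁, hL₁⟩ := he
    exact ⟨L₁, fun L hL x hx => hL₁ L hL x (ofReal_mem_ball_iff.1 hx)⟩
  · exact fun x hx => hf x (ofReal_mem_ball_iff.1 hx)

/-- **A real non-analyticity of the bulk free energy blocks the axis** (`AxisBlocked`): under the
same limit hypotheses, if `f` is NOT real analytic at `c` — e.g. a first-order bulk transition at
`c` (van Enter–Shlosman, Commun. Math. Phys. 255 (2005) 21, Thm. 2, for the admissible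
representations `(2N·𝟙 ⊕ V ⊕ V̄)^{⊗p}` of `SU(N)`, `p` large) — then NO disc about `c` is
uniformly zero-free for the tubes. [folklore] -/
theorem not_zeroFree_ball_of_not_analyticAt (r : LatticeRep G) {c R₀ : ℝ} (hR₀ : 0 < R₀)
    {e : ℕ → ℝ → ℝ} {f : ℝ → ℝ}
    (he : ∃ L₁ : ℕ, ∀ L, L₁ ≤ L → ∀ x : ℝ, |x - c| < R₀ →
      Tendsto (fun t : ℕ => Real.log ‖boxZ r x L t‖ / ((L : ℝ) ^ 3 * t)) atTop (𝓝 (e L x)))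
    (hf : ∀ x : ℝ, |x - c| < R₀ → Tendsto (fun L => e L x) atTop (𝓝 (f x)))
    (hna : ¬ AnalyticAt ℝ f c) {R : ℝ} (hR : 0 < R) :
    ¬ ∃ L₀ : ℕ, ∀ L, L₀ ≤ L → ∃ t₀ : ℕ, ∀ t, t₀ ≤ t → ∀ z ∈ ball (c : ℂ) R, boxZ r z L t ≠ 0 := by
  intro hzf
  apply hna
  -- shrink to the radius `min R R₀`
  set R' : ℝ := min R R₀ with hR'
  have hR'0 : 0 < R' := lt_min hR hR₀
  refine analyticAt_of_boxZ_zeroFree r hR'0 ?_ (e := e) ?_ ?_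
  · obtain ⟨L₀, hL₀⟩ := hzf
    refine ⟨L₀, fun L hL => ?_⟩
    obtain ⟨t₀, ht₀⟩ := hL₀ L hL
    exact ⟨t₀, fun t ht z hz => ht₀ t ht z (ball_subset_ball (min_le_left _ _) hz)⟩
  · obtain ⟨L₁, hL₁⟩ := he
    exact ⟨L₁, fun L hL x hx => hL₁ L hL x (lt_of_lt_of_le hx (min_le_right _ _))⟩
  · exact fun x hx => hf x (lt_of_lt_of_le hx (min_le_right _ _))

/-- **No uniformly zero-free open set contains a wall point.** [folklore] -/
theorem not_zeroFree_of_mem (r : LatticeRep G) {c R₀ : ℝ} (hR₀ : 0 < R₀)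
    {e : ℕ → ℝ → ℝ} {f : ℝ → ℝ}
    (he : ∃ L₁ : ℕ, ∀ L, L₁ ≤ L → ∀ x : ℝ, |x - c| < R₀ →
      Tendsto (fun t : ℕ => Real.log ‖boxZ r x L t‖ / ((L : ℝ) ^ 3 * t)) atTop (𝓝 (e L x)))
    (hf : ∀ x : ℝ, |x - c| < R₀ → Tendsto (fun L => e L x) atTop (𝓝 (f x)))
    (hna : ¬ AnalyticAt ℝ f c) {D : Set ℂ} (hD : IsOpen D) (hcD : (c : ℂ) ∈ D) :
    ¬ ∃ L₀ : ℕ, ∀ L, L₀ ≤ L → ∃ t₀ : ℕ, ∀ t, t₀ ≤ t → ∀ z ∈ D, boxZ r z L t ≠ 0 := by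
  obtain ⟨R, hR, hball⟩ := Metric.isOpen_iff.1 hD _ hcD
  intro hzf
  refine not_zeroFree_ball_of_not_analyticAt r hR₀ he hf hna hR ?_
  obtain ⟨L₀, hL₀⟩ := hzf
  refine ⟨L₀, fun L hL => ?_⟩
  obtain ⟨t₀, ht₀⟩ := hL₀ L hL
  exact ⟨t₀, fun t ht z hz => ht₀ t ht z (hball hz)⟩

/-- **Channels through a wall leave the real axis**: an open connected uniformly zero-free `D`
containing real couplings `a < c < b` on both sides of a wall point `c` does not contain `c`, and
crosses the line `Re z = c` at a NON-REAL point. In particular every channel of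
`TubeZeroFreeChannel` joining the strong-coupling disc to `β > c` makes a genuinely complex detour
around `c`: the axis-hugging strip form of the crux (x5's corridor) is false at such `(G, r)`. [folklore] -/
theorem exists_nonreal_mem_of_zeroFree_connected (r : LatticeRep G) {c R₀ : ℝ} (hR₀ : 0 < R₀)
    {e : ℕ → ℝ → ℝ} {f : ℝ → ℝ}
    (he : ∃ L₁ : ℕ, ∀ L, L₁ ≤ L → ∀ x : ℝ, |x - c| < R₀ →
      Tendsto (fun t : ℕ => Real.log ‖boxZ r x L t‖ / ((L : ℝ) ^ 3 * t)) atTop (𝓝 (e L x)))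
    (hf : ∀ x : ℝ, |x - c| < R₀ → Tendsto (fun L => e L x) atTop (𝓝 (f x)))
    (hna : ¬ AnalyticAt ℝ f c) {D : Set ℂ} (hD : IsOpen D) (hDc : IsConnected D)
    (hzf : ∃ L₀ : ℕ, ∀ L, L₀ ≤ L → ∃ t₀ : ℕ, ∀ t, t₀ ≤ t → ∀ z ∈ D, boxZ r z L t ≠ 0)
    {a b : ℝ} (ha : (a : ℂ) ∈ D) (hb : (b : ℂ) ∈ D) (hac : a ≤ c) (hcb : c ≤ b) :
    (c : ℂ) ∉ D ∧ ∃ w ∈ D, w.re = c ∧ w.im ≠ 0 := by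
  have hc : (c : ℂ) ∉ D := fun hcD => not_zeroFree_of_mem r hR₀ he hf hna hD hcD hzf
  refine ⟨hc, ?_⟩
  have hiv : c ∈ Complex.re '' D := by
    have := hDc.isPreconnected.intermediate_value ha hb Complex.continuous_re.continuousOn
    exact this ⟨by simpa using hac, by simpa using hcb⟩
  obtain ⟨w, hwD, hw⟩ := hiv
  refine ⟨w, hwD, hw, fun him => hc ?_⟩
  have : w = (c : ℂ) := Complex.ext (by simpa using hw) (by simpa using him)
  exact this ▸ hwD

end Crux

/-! ### IV. Consequences for the crux `TubeZeroFreeChannel` -/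

section Consequences

open Summit.QuantumFields.YangMills.Theses.ComplexCouplingChannel (TubeZeroFreeChannel)

/-- The route decl `TubeZeroFreeChannel` over `boxZ`, definitionally (`Iff.rfl`). [folklore] -/
theorem tubeZeroFreeChannel_iff_boxZ : TubeZeroFreeChannel ↔
    ∀ (G : Type) [Group G] [TopologicalSpace G] [IsTopologicalGroup G] [CompactSpace G]
      [MeasurableSpace G] [BorelSpace G], IsCompactSimpleLieGroup G → ∀ r : LatticeRep G,
      ∃ β₁ : ℝ, ∀ β : ℝ, β₁ ≤ β → ∀ ρ : ℝ, 0 < ρ → ∃ D : Set ℂ, IsOpen D ∧ IsConnected D ∧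
        (β : ℂ) ∈ D ∧ (∃ x : ℝ, |x| < ρ ∧ (x : ℂ) ∈ D) ∧
        ∃ L₀ : ℕ, ∀ L : ℕ, L₀ ≤ L → ∃ t₀ : ℕ, ∀ t : ℕ, t₀ ≤ t → ∀ z ∈ D, boxZ r z L t ≠ 0 :=
  Iff.rfl

variable {G : Type} [Group G] [TopologicalSpace G] [IsTopologicalGroup G] [CompactSpace G]
  [MeasurableSpace G] [BorelSpace G]

/-- **The channels of the crux detour around a wall.** If `TubeZeroFreeChannel` holds and an
admissible `(G, r)` has a wall at a real `c > 0` (tube rates and bulk free energy exist near `c`,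
`f` not analytic at `c`), then for every large `β` the channel `D ∋ β` the crux provides at tolerance
`ρ = c` misses `c` and contains a non-real point on the line `Re z = c`. [folklore] -/
theorem channel_detours_of_wall (h : TubeZeroFreeChannel) (hG : IsCompactSimpleLieGroup G)
    (r : LatticeRep G) {c R₀ : ℝ} (hc : 0 < c) (hR₀ : 0 < R₀) {e : ℕ → ℝ → ℝ} {f : ℝ → ℝ}
    (he : ∃ L₁ : ℕ, ∀ L, L₁ ≤ L → ∀ x : ℝ, |x - c| < R₀ →
      Tendsto (fun t : ℕ => Real.log ‖boxZ r x L t‖ / ((L : ℝ) ^ 3 * t)) atTop (𝓝 (e L x)))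
    (hf : ∀ x : ℝ, |x - c| < R₀ → Tendsto (fun L => e L x) atTop (𝓝 (f x)))
    (hna : ¬ AnalyticAt ℝ f c) :
    ∃ β₁ : ℝ, ∀ β : ℝ, β₁ ≤ β → ∃ D : Set ℂ, IsOpen D ∧ IsConnected D ∧ (β : ℂ) ∈ D ∧
      (∃ x : ℝ, |x| < c ∧ (x : ℂ) ∈ D) ∧
      (∃ L₀ : ℕ, ∀ L : ℕ, L₀ ≤ L → ∃ t₀ : ℕ, ∀ t : ℕ, t₀ ≤ t → ∀ z ∈ D, boxZ r z L t ≠ 0) ∧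
      (c : ℂ) ∉ D ∧ ∃ w ∈ D, w.re = c ∧ w.im ≠ 0 := by
  obtain ⟨β₁, hβ₁⟩ := (tubeZeroFreeChannel_iff_boxZ.1 h) G hG r
  refine ⟨max β₁ c, fun β hβ => ?_⟩
  obtain ⟨D, hDo, hDc, hβD, ⟨x, hx, hxD⟩, hzf⟩ := hβ₁ β (le_trans (le_max_left _ _) hβ) c hc
  have hxc : x ≤ c := (abs_lt.1 hx).2.le
  have hcβ : c ≤ β := le_trans (le_max_right _ _) hβ
  obtain ⟨hcD, w, hwD, hw⟩ :=
    exists_nonreal_mem_of_zeroFree_connected r hR₀ he hf hna hDo hDc hzf hxD hβD hxc hcβ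
  exact ⟨D, hDo, hDc, hβD, ⟨x, hx, hxD⟩, hzf, hcD, w, hwD, hw⟩

/-- The open `δ`-box about the real segment `[0, B]`. [folklore] -/
theorem isOpen_box (B δ : ℝ) :
    IsOpen {z : ℂ | -δ < z.re ∧ z.re < B + δ ∧ -δ < z.im ∧ z.im < δ} :=
  (isOpen_lt continuous_const Complex.continuous_re).inter
    ((isOpen_lt Complex.continuous_re continuous_const).inter
      ((isOpen_lt continuous_const Complex.continuous_im).inter
        (isOpen_lt Complex.continuous_im continuous_const)))

/-- **The strip form of the crux is false at a wall.** The axis-hugging strengthening of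
`TubeZeroFreeChannel` — a whole `δ`-box about `[0, β]` uniformly zero-free for the tubes, `β` large
(the 2001 x5 corridor; the strategist's `StripCorridor`, which implies the crux by convexity) —
fails as soon as ONE admissible `(G, r)` has a wall at some real `c > 0`: any proof of the crux at
such `(G, r)` must leave the real axis. [folklore] -/
theorem not_stripChannel_of_wall (hG : IsCompactSimpleLieGroup G) (r : LatticeRep G) {c R₀ : ℝ}
    (hc : 0 < c) (hR₀ : 0 < R₀) {e : ℕ → ℝ → ℝ} {f : ℝ → ℝ}
    (he : ∃ L₁ : ℕ, ∀ L, L₁ ≤ L → ∀ x : ℝ, |x - c| < R₀ →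
      Tendsto (fun t : ℕ => Real.log ‖boxZ r x L t‖ / ((L : ℝ) ^ 3 * t)) atTop (𝓝 (e L x)))
    (hf : ∀ x : ℝ, |x - c| < R₀ → Tendsto (fun L => e L x) atTop (𝓝 (f x)))
    (hna : ¬ AnalyticAt ℝ f c) :
    ¬ ∀ (G : Type) [Group G] [TopologicalSpace G] [IsTopologicalGroup G] [CompactSpace G]
        [MeasurableSpace G] [BorelSpace G], IsCompactSimpleLieGroup G → ∀ r : LatticeRep G,
        ∃ β₁ : ℝ, ∀ β : ℝ, β₁ ≤ β → ∃ δ : ℝ, 0 < δ ∧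
          ∃ L₀ : ℕ, ∀ L : ℕ, L₀ ≤ L → ∃ t₀ : ℕ, ∀ t : ℕ, t₀ ≤ t → ∀ z : ℂ,
            -δ < z.re → z.re < β + δ → -δ < z.im → z.im < δ → boxZ r z L t ≠ 0 := by
  intro hS
  obtain ⟨β₁, hβ₁⟩ := hS G hG r
  obtain ⟨δ, hδ, L₀, hL₀⟩ := hβ₁ (max β₁ c) (le_max_left _ _)
  have hcD : (c : ℂ) ∈ {z : ℂ | -δ < z.re ∧ z.re < max β₁ c + δ ∧ -δ < z.im ∧ z.im < δ} := by
    simp only [mem_setOf_eq, Complex.ofReal_re, Complex.ofReal_im]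
    exact ⟨by linarith, by linarith [le_max_right β₁ c], by linarith, hδ⟩
  refine not_zeroFree_of_mem r hR₀ he hf hna (isOpen_box (max β₁ c) δ) hcD ⟨L₀, fun L hL => ?_⟩
  obtain ⟨t₀, ht₀⟩ := hL₀ L hL
  exact ⟨t₀, fun t ht z hz => ht₀ t ht z hz.1 hz.2.1 hz.2.2.1 hz.2.2.2⟩

end Consequences

end Summit.QuantumFields.YangMills.Theorems.TubeZeroFreeChannel.Negative
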